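import Mathlib
import Literature.Geometry.Lorentzian.BogovskiiScalarDivergence
import Literature.Geometry.Lorentzian.BogovskiiVectorL1Bound
import Literature.Analysis.FluidPDE.CoordDerivatives
import Literature.Analysis.FluidPDE.NecasRuzickaSverakRRS
import HarnessLib

/-!
# Bogovskiĭ's right inverse of the divergence on a ball: smooth compactly supported solutions with the
# SCALE-INVARIANT SUP BOUND `‖w‖_∞ ≤ C·ρ·‖h‖_∞`

Analysis/FluidPDE support file (everything proved; no definitions, no named facts).  For the ball `B̄(0,ρ)` of `ℝ³`
and a smooth compactly supported scalar `h` with `h = 0` off `B̄(0,ρ)`, `∫ h = 0` and `|h| ≤ M`, Bogovskiĭ's formula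
(Bogovskiĭ 1979; Galdi, *An Introduction to the Mathematical Theory of the Navier–Stokes Equations*, 2nd ed. 2011,
§III.3, Lemma III.3.1 with the estimate (III.3.20)) gives a smooth vector field `w`, `w = 0` off `B̄(0,ρ)`, with
`div w = h` and — the point of this file — the order-zero estimate in sup norm with its natural scaling,
`‖w(x)‖ ≤ C·ρ·M` for an ABSOLUTE constant `C`:

* `exists_smooth_divInverse_unitBall_norm_le` — the unit ball: the tree's vector Bogovskiĭ operator `SV_ζ h` of
  Mao–Oh–Tao's Lemma 2.3 (`Literature.Geometry.Lorentzian.MaoOhTao.bogovskiiSV`, with the normalised bump `ζ` of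
  `B(0,1/2)`) is smooth (`contDiff_infty_bogovskiiVOperator`), carried by the segments from `B̄(0,1/2)` to the support of
  `h` (`support_bogovskiiSV_subset`), solves `div = h` (`sum_pd_bogovskiiSV_eq_self`), and obeys the `L^∞ → L^∞` bound
  `exists_supConst_bogovskiiSV` whose constant depends on `ζ` and the unit radius only;
* `exists_smooth_divInverse_ball_norm_le` — any radius `ρ > 0`, by the scaling `w(x) = ρ·w₁(x/ρ)` of the unit-ball
  solution for `h₁(y) = h(ρy)` (`div (ρ·w₁(ρ⁻¹·)) = (div w₁)(ρ⁻¹·)`, `divergence_const_smul_comp_smul`).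

Consumer: the far-field surgery of cut-off correctors (a compactly supported replacement of the harmonic tail of a
Leray projection, where the source `∇χ_R·∇π` lives at scale `R` with size `≍ R⁻¹·sup|∇π|` and the corrector must be
`O(sup|∇π|)`, uniformly in `R`).  Mathlib/tree search: `bogovskiiSV`, `exists_supConst_bogovskiiSV`,
`exists_smooth_divInverse_of_starConvex` (existence without the bound), `divergence_const_smul_comp_smul`,
`Measure.integral_comp_smul`, `HasCompactSupport.comp_smul`.

## References

* G. P. Galdi, *An Introduction to the Mathematical Theory of the Navier–Stokes Equations. Steady-State Problems*,
  2nd ed., Springer (2011), §III.3, Lemma III.3.1 and (III.3.20) (key `Galdi2011`).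
* M. E. Bogovskiĭ, Dokl. Akad. Nauk SSSR 248 (1979), 1037–1040.
* Y. Mao, S.-J. Oh, T. Tao, arXiv:2308.13031 (2023), Lemma 2.3 (key `MaoOhTao2023`).
-/

noncomputable section

open scoped RealInnerProductSpace Topology ContDiff
open Filter MeasureTheory Set Metric Function

namespace Literature.Analysis.FluidPDE

open Literature.Geometry.Lorentzian Literature.Geometry.Lorentzian.MaoOhTao

/-- **Bogovskiĭ on the unit ball with the sup bound**: there is an absolute `C > 0` such that every smooth compactly
supported `h : ℝ³ → ℝ` vanishing off the closed unit ball, with `∫ h = 0` and `|h| ≤ M`, is the divergence of a smooth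
vector field `w` vanishing off the closed unit ball with `‖w(x)‖ ≤ C·M` everywhere (`w = SV_ζ h`, `ζ` the normalised bump
of `B(0,1/2)`). [cite: Galdi2011, Lemma III.3.1 and (III.3.20)] -/
theorem exists_smooth_divInverse_unitBall_norm_le :
    ∃ C : ℝ, 0 < C ∧ ∀ (h : EuclideanSpace ℝ (Fin 3) → ℝ) (M : ℝ), ContDiff ℝ ∞ h → HasCompactSupport h →
      (∀ y, h y ≠ 0 → ‖y‖ ≤ 1) → ∫ y, h y = 0 → (∀ y, |h y| ≤ M) →
      ∃ w : EuclideanSpace ℝ (Fin 3) → EuclideanSpace ℝ (Fin 3), ContDiff ℝ ∞ w ∧ HasCompactSupport w ∧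
        (∀ x, w x ≠ 0 → ‖x‖ ≤ 1) ∧ (∀ x, VectorCalculus.divergence w x = h x) ∧ ∀ x, ‖w x‖ ≤ C * M := by
  -- the normalised bump `ζ` of `ball 0 (1/2)`
  let bmp : ContDiffBump (0 : EuclideanSpace ℝ (Fin 3)) := ⟨1 / 4, 1 / 2, by norm_num, by norm_num⟩
  set ζ : EuclideanSpace ℝ (Fin 3) → ℝ := bmp.normed volume with hζdef
  have hζ : ContDiff ℝ ∞ ζ := bmp.contDiff_normed
  have hζ1 : ∫ z, ζ z = 1 := bmp.integral_normed
  have hζB : ∀ z, ζ z ≠ 0 → z ∈ closedBall (0 : EuclideanSpace ℝ (Fin 3)) (1 / 2) := fun z hz ↦ by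
    have : z ∈ support ζ := mem_support.2 hz
    rw [hζdef, bmp.support_normed_eq] at this
    exact ball_subset_closedBall this
  have hR : ∀ z : EuclideanSpace ℝ (Fin 3), 1 / 2 < ‖z‖ → ζ z = 0 := by
    intro z hz
    by_contra hne
    have hzB := hζB z hne
    rw [mem_closedBall, dist_zero_right] at hzB
    linarith
  -- the `L^∞ → L^∞` constant of `SV_ζ` on densities in the closed unit ball
  obtain ⟨C, hC0, hsup⟩ := exists_supConst_bogovskiiSV hζ.continuous hR 1
  refine ⟨2 * C + 1, by linarith, ?_⟩
  intro h M hh hhc hh1 hh0 hM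
  have hM0 : 0 ≤ M := (abs_nonneg _).trans (hM 0)
  -- support bookkeeping: the segments from `B̄(0,1/2)` to `supp h` stay in the (convex) closed unit ball
  have hΩ : ∀ b ∈ closedBall (0 : EuclideanSpace ℝ (Fin 3)) (1 / 2),
      StarConvex ℝ b (closedBall (0 : EuclideanSpace ℝ (Fin 3)) 1) := fun b hb ↦
    (convex_closedBall _ _).starConvex (closedBall_subset_closedBall (by norm_num) hb)
  have hhΩ : ∀ y, h y ≠ 0 → y ∈ closedBall (0 : EuclideanSpace ℝ (Fin 3)) 1 := fun y hy ↦ by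
    rw [mem_closedBall, dist_zero_right]; exact hh1 y hy
  have hsuppa : ∀ a, support (bogovskiiSV ζ h a) ⊆ closedBall (0 : EuclideanSpace ℝ (Fin 3)) 1 := fun a ↦
    support_bogovskiiSV_subset hΩ hζB hhΩ a
  -- the components and the vector field
  have hca : ∀ a, ContDiff ℝ ∞ (bogovskiiSV ζ h a) := fun a ↦ contDiff_infty_bogovskiiVOperator hζ hR hh hhc a
  set w : EuclideanSpace ℝ (Fin 3) → EuclideanSpace ℝ (Fin 3) :=
    fun x ↦ WithLp.toLp 2 fun a ↦ bogovskiiSV ζ h a x with hwdef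
  have hcomp : ∀ a, (fun x ↦ w x a) = bogovskiiSV ζ h a := fun a ↦ rfl
  have hws : ContDiff ℝ ∞ w := contDiff_euclidean.2 fun a ↦ by rw [hcomp a]; exact hca a
  have hw0 : ∀ x, w x ≠ 0 → ‖x‖ ≤ 1 := by
    intro x hx
    by_contra hx1
    apply hx
    ext a
    have : x ∉ support (bogovskiiSV ζ h a) := fun hx' ↦ by
      have := hsuppa a hx'
      rw [mem_closedBall, dist_zero_right] at this
      exact hx1 this
    simpa [hwdef] using notMem_support.1 this
  have hwc : HasCompactSupport w := by
    refine HasCompactSupport.intro (isCompact_closedBall (0 : EuclideanSpace ℝ (Fin 3)) 1) fun x hx ↦ ?_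
    by_contra hne
    exact hx (by rw [mem_closedBall, dist_zero_right]; exact hw0 x hne)
  -- the sup bound on the components, hence on the Euclidean norm
  have hcompbd : ∀ a x, |bogovskiiSV ζ h a x| ≤ C * M := fun a x ↦ hsup h hh.continuous hh1 M hM a x
  have hnorm : ∀ x, ‖w x‖ ≤ (2 * C + 1) * M := by
    intro x
    have hCM : 0 ≤ C * M := mul_nonneg hC0 hM0
    have hsq : ∀ a, ‖w x a‖ ^ 2 ≤ (C * M) ^ 2 := fun a ↦ by
      rw [Real.norm_eq_abs, sq_abs]
      have := hcompbd a x
      rw [← hcomp a] at this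
      exact sq_le_sq' (by linarith [neg_abs_le (w x a), this]) ((le_abs_self _).trans this)
    have hsum : ∑ a, ‖w x a‖ ^ 2 ≤ 3 * (C * M) ^ 2 := by
      calc ∑ a, ‖w x a‖ ^ 2 ≤ ∑ _a : Fin 3, (C * M) ^ 2 := Finset.sum_le_sum fun a _ ↦ hsq a
        _ = 3 * (C * M) ^ 2 := by simp
    rw [EuclideanSpace.norm_eq]
    calc Real.sqrt (∑ a, ‖w x a‖ ^ 2) ≤ Real.sqrt ((2 * (C * M)) ^ 2) :=
          Real.sqrt_le_sqrt (by nlinarith)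
      _ = 2 * (C * M) := Real.sqrt_sq (by positivity)
      _ ≤ (2 * C + 1) * M := by nlinarith
  refine ⟨w, hws, hwc, hw0, fun x ↦ ?_, hnorm⟩
  -- the divergence in coordinates
  rw [divergence_eq_sum_pderiv ((hws.differentiable (by simp)) x)]
  exact sum_pd_bogovskiiSV_eq_self (hζ.of_le (by norm_cast)) hR hζ1 (hh.of_le (by norm_cast)) hhc hh0 x

/-- **Bogovskiĭ on the ball `B̄(0,ρ)` with the scale-invariant sup bound**: there is an absolute `C > 0` such that for
every `ρ > 0` and every smooth compactly supported `h : ℝ³ → ℝ` vanishing off `B̄(0,ρ)`, with `∫ h = 0` and `|h| ≤ M`,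
there is a smooth vector field `w` vanishing off `B̄(0,ρ)` with `div w = h` and `‖w(x)‖ ≤ C·ρ·M` everywhere (scaling
`w(x) = ρ·w₁(x/ρ)` of the unit-ball solution for `h(ρ·)`). [cite: Galdi2011, Lemma III.3.1 and (III.3.20)] -/
theorem exists_smooth_divInverse_ball_norm_le :
    ∃ C : ℝ, 0 < C ∧ ∀ (ρ : ℝ) (h : EuclideanSpace ℝ (Fin 3) → ℝ) (M : ℝ), 0 < ρ → ContDiff ℝ ∞ h →
      HasCompactSupport h → (∀ y, h y ≠ 0 → ‖y‖ ≤ ρ) → ∫ y, h y = 0 → (∀ y, |h y| ≤ M) →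
      ∃ w : EuclideanSpace ℝ (Fin 3) → EuclideanSpace ℝ (Fin 3), ContDiff ℝ ∞ w ∧ HasCompactSupport w ∧
        (∀ x, w x ≠ 0 → ‖x‖ ≤ ρ) ∧ (∀ x, VectorCalculus.divergence w x = h x) ∧ ∀ x, ‖w x‖ ≤ C * ρ * M := by
  obtain ⟨C, hC, hunit⟩ := exists_smooth_divInverse_unitBall_norm_le
  refine ⟨C, hC, ?_⟩
  intro ρ h M hρ hh hhc hhρ hh0 hM
  have hρ0 : ρ ≠ 0 := hρ.ne'
  -- the rescaled source `h₁ y = h (ρ • y)` lives in the unit ball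
  set h₁ : EuclideanSpace ℝ (Fin 3) → ℝ := fun y ↦ h (ρ • y) with hh₁def
  have hh₁ : ContDiff ℝ ∞ h₁ := hh.comp (contDiff_const_smul ρ)
  have hh₁c : HasCompactSupport h₁ := hhc.comp_smul hρ0
  have hh₁1 : ∀ y, h₁ y ≠ 0 → ‖y‖ ≤ 1 := by
    intro y hy
    have h1 := hhρ (ρ • y) hy
    rw [norm_smul, Real.norm_eq_abs, abs_of_pos hρ] at h1
    nlinarith
  have hh₁0 : ∫ y, h₁ y = 0 := by
    have := Measure.integral_comp_smul volume h ρ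
    simp only [hh0, smul_zero] at this
    exact this
  have hh₁M : ∀ y, |h₁ y| ≤ M := fun y ↦ hM _
  obtain ⟨w₁, hw₁, hw₁c, hw₁1, hdiv₁, hnorm₁⟩ := hunit h₁ M hh₁ hh₁c hh₁1 hh₁0 hh₁M
  -- the rescaled solution `w x = ρ • w₁ (ρ⁻¹ • x)`
  refine ⟨fun x ↦ ρ • w₁ (ρ⁻¹ • x), (hw₁.comp (contDiff_const_smul ρ⁻¹)).const_smul ρ, ?_, ?_, ?_, ?_⟩
  · exact ((hw₁c.comp_smul (inv_ne_zero hρ0)).smul_left (f := fun _ : EuclideanSpace ℝ (Fin 3) ↦ ρ))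
  · intro x hx
    have hne : w₁ (ρ⁻¹ • x) ≠ 0 := fun h0 ↦ hx (show ρ • w₁ (ρ⁻¹ • x) = 0 by rw [h0, smul_zero])
    have h1 := hw₁1 _ hne
    rw [norm_smul, norm_inv, Real.norm_eq_abs, abs_of_pos hρ] at h1
    rwa [inv_mul_le_iff₀ hρ, mul_one] at h1
  · intro x
    rw [divergence_const_smul_comp_smul w₁ ρ ρ⁻¹ x, mul_inv_cancel₀ hρ0, one_mul, hdiv₁]
    simp only [hh₁def, smul_smul, mul_inv_cancel₀ hρ0, one_smul]
  · intro x
    rw [norm_smul, Real.norm_eq_abs, abs_of_pos hρ]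
    calc ρ * ‖w₁ (ρ⁻¹ • x)‖ ≤ ρ * (C * M) := mul_le_mul_of_nonneg_left (hnorm₁ _) hρ.le
      _ = C * ρ * M := by ring

end Literature.Analysis.FluidPDE

end
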